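import Literature.MathematicalPhysics.QuantumFieldTheory.PinnedOneLinkLaplace
import Mathlib.MeasureTheory.Measure.Lebesgue.EqHaar
import HarnessLib

/-!
# Volume doubling of Haar measure for Hilbert–Schmidt balls on a compact matrix group

First file of the proof of the named fact
`Literature.MathematicalPhysics.QuantumFieldTheory.OneLinkLaplaceConcentration`
(`PinnedOneLinkLaplace.lean`: Laplace concentration of strongly pinned one-link laws). The Laplace
estimate there is driven not by Weyl's integration formula or an exponential chart for Haar measure
but by the following soft fact: for a compact group `G` with a continuous unitary matrix
representation `ρ : G → U(N)`, the Haar probability of the Hilbert–Schmidt balls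
`B(g₀, t) = {g | ‖ρ g - ρ g₀‖_F ≤ t}` is **doubling at every scale**,

  `σ(B(g₀, 2t)) ≤ 5^{2N²} σ(B(g₀, t))`      (`haar_frobBall_two_mul_le`),

uniformly in `g₀` and `t ≥ 0`. Proof: `M_N(ℂ) ≅ ℝ^{2N²}` isometrically for `‖·‖_F`
(`norm_vecEuclid_sub`), Lebesgue measure there is exactly `5^{2N²}`-homogeneous on balls, and a
Fubini count of the pairs `(g, y)` with `g ∈ B(g₀, 2t)`, `|y - ρ g| ≤ t/2` bounds `σ(B(g₀,2t))·vol(t/2)`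
by `V(t)·vol(5t/2)`, where `V(t) = sup_{g₁} σ(B(g₁, t)) = σ(B(g₀, t))` by left invariance of `σ` and
unitary invariance of `‖·‖_F` (`measure_norm_sub_le_two_mul_le`, an abstract covering lemma in
measure form, then `haar_frobBall_eq`). This is the standard "subsets of a doubling space are
doubling" remark (Heinonen, *Lectures on Analysis on Metric Spaces* (2001), §10.13–10.16;
Coifman–Weiss, LNM 242 (1971), Ch. III §1) made quantitative for bi-invariant chordal metrics.
Everything is proved; no definitions.
-/

noncomputable section

open MeasureTheory Set Metric
open scoped ENNReal

namespace Literature.MathematicalPhysics.QuantumFieldTheory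

section Covering

variable {X : Type*} [MeasurableSpace X] {ι : Type*} [Fintype ι]

/-- **Covering lemma in measure form.** If every ball `{x | ‖f x - f x₁‖ ≤ R}` pulled back along a
measurable map `f : X → ℝ^ι` has `μ`-measure at most `V`, then every pulled-back ball of radius `2R`
has measure at most `5^{#ι} V` (Fubini over the pairs `(x, y)`, `|y - f x| ≤ R/2`, and homogeneity
of Lebesgue measure). [folklore] -/
theorem measure_norm_sub_le_two_mul_le (μ : Measure X) [SFinite μ] {f : X → EuclideanSpace ℝ ι}
    (hf : Measurable f) {R : ℝ} (hR : 0 < R) (c : EuclideanSpace ℝ ι) {V : ℝ≥0∞}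
    (hV : ∀ x₁, μ {x | ‖f x - f x₁‖ ≤ R} ≤ V) :
    μ {x | ‖f x - c‖ ≤ 2 * R} ≤ 5 ^ Fintype.card ι * V := by
  set ν : Measure (EuclideanSpace ℝ ι) := volume with hν
  set S : Set X := {x | ‖f x - c‖ ≤ 2 * R} with hS
  have hfc : Measurable fun x => ‖f x - c‖ := (hf.sub_const c).norm
  have hSm : MeasurableSet S := measurableSet_le hfc measurable_const
  set K : Set (X × EuclideanSpace ℝ ι) :=
    {p | ‖f p.1 - c‖ ≤ 2 * R ∧ ‖p.2 - f p.1‖ ≤ R / 2} with hK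
  have hKm : MeasurableSet K :=
    (measurableSet_le (hfc.comp measurable_fst) measurable_const).inter
      (measurableSet_le (measurable_snd.sub (hf.comp measurable_fst)).norm measurable_const)
  set B : ℝ≥0∞ := ν (closedBall (0 : EuclideanSpace ℝ ι) (R / 2)) with hB
  -- fibres over `x`
  have h1 : (μ.prod ν) K = B * μ S := by
    rw [Measure.prod_apply hKm]
    have hfib : ∀ x, ν (Prod.mk x ⁻¹' K) = S.indicator (fun _ => B) x := by
      intro x
      by_cases hx : x ∈ S
      · rw [indicator_of_mem hx]
        have hx' : ‖f x - c‖ ≤ 2 * R := hx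
        have : Prod.mk x ⁻¹' K = closedBall (f x) (R / 2) := by
          ext y
          simp only [mem_preimage, hK, mem_setOf_eq, mem_closedBall, dist_eq_norm]
          exact ⟨fun h => h.2, fun h => ⟨hx', h⟩⟩
        rw [this, hB, Measure.addHaar_closedBall_center]
      · rw [indicator_of_notMem hx]
        have : Prod.mk x ⁻¹' K = ∅ := by
          ext y
          simp only [mem_preimage, hK, mem_setOf_eq, mem_empty_iff_false, iff_false, not_and]
          exact fun h _ => hx h
        rw [this, measure_empty]
    simp_rw [hfib]
    rw [lintegral_indicator_const hSm]
  -- fibres over `y`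
  have h2 : (μ.prod ν) K ≤ V * ν (closedBall c (5 * (R / 2))) := by
    rw [Measure.prod_apply_symm hKm]
    have hle : ∀ y, μ ((fun x => (x, y)) ⁻¹' K) ≤ (closedBall c (5 * (R / 2))).indicator (fun _ => V) y := by
      intro y
      by_cases hy : ((fun x => (x, y)) ⁻¹' K).Nonempty
      · obtain ⟨x₁, hx₁⟩ := hy
        simp only [mem_preimage, hK, mem_setOf_eq] at hx₁
        have hyc : y ∈ closedBall c (5 * (R / 2)) := by
          rw [mem_closedBall, dist_eq_norm]
          calc ‖y - c‖ ≤ ‖y - f x₁‖ + ‖f x₁ - c‖ := norm_sub_le_norm_sub_add_norm_sub _ _ _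
            _ ≤ R / 2 + 2 * R := add_le_add hx₁.2 hx₁.1
            _ = 5 * (R / 2) := by ring
        rw [indicator_of_mem hyc]
        refine (measure_mono ?_).trans (hV x₁)
        intro x hx
        simp only [mem_preimage, hK, mem_setOf_eq] at hx
        show ‖f x - f x₁‖ ≤ R
        calc ‖f x - f x₁‖ ≤ ‖f x - y‖ + ‖y - f x₁‖ := norm_sub_le_norm_sub_add_norm_sub _ _ _
          _ = ‖y - f x‖ + ‖y - f x₁‖ := by rw [norm_sub_rev]
          _ ≤ R / 2 + R / 2 := add_le_add hx.2 hx₁.2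
          _ = R := by ring
      · rw [not_nonempty_iff_eq_empty.1 hy, measure_empty]
        exact zero_le
    calc ∫⁻ y, μ ((fun x => (x, y)) ⁻¹' K) ∂ν
        ≤ ∫⁻ y, (closedBall c (5 * (R / 2))).indicator (fun _ => V) y ∂ν := lintegral_mono hle
      _ = V * ν (closedBall c (5 * (R / 2))) := lintegral_indicator_const measurableSet_closedBall _
  -- homogeneity of Lebesgue measure
  have h3 : ν (closedBall c (5 * (R / 2))) = 5 ^ Fintype.card ι * B := by
    rw [Measure.addHaar_closedBall_mul ν c (by norm_num : (0 : ℝ) ≤ 5) (by linarith : 0 ≤ R / 2),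
      finrank_euclideanSpace, ENNReal.ofReal_pow (by norm_num : (0 : ℝ) ≤ 5)]
    norm_num [hB]
  have hpos : B ≠ 0 := (measure_closedBall_pos ν _ (by linarith : 0 < R / 2)).ne'
  have htop : B ≠ ∞ := measure_closedBall_lt_top.ne
  have hmain : μ S * B ≤ 5 ^ Fintype.card ι * V * B := by
    calc μ S * B = (μ.prod ν) K := by rw [h1, mul_comm]
      _ ≤ V * ν (closedBall c (5 * (R / 2))) := h2
      _ = 5 ^ Fintype.card ι * V * B := by rw [h3]; ring
  exact (ENNReal.mul_le_mul_iff_left hpos htop).1 hmain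

end Covering

section Group

variable {G : Type*} [Group G] [TopologicalSpace G] [IsTopologicalGroup G] [CompactSpace G]
  [MeasurableSpace G] [BorelSpace G] {N : ℕ}

/-- The real coordinates `(Re Aᵢⱼ, Im Aᵢⱼ)` of a complex matrix, as a point of `ℝ^{N × N × 2}`
with its Euclidean norm: an `ℝ`-linear isometry for `‖·‖_F`, written inline. Its norm is the
Frobenius norm. [folklore] -/
theorem norm_vecEuclid (A : Matrix (Fin N) (Fin N) ℂ) :
    ‖(WithLp.toLp 2 (fun p : Fin N × Fin N × Fin 2 =>
        if p.2.2 = 0 then (A p.1 p.2.1).re else (A p.1 p.2.1).im) :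
        EuclideanSpace ℝ (Fin N × Fin N × Fin 2))‖ = frobNorm A := by
  rw [EuclideanSpace.norm_eq, frobNorm]
  congr 1
  rw [Fintype.sum_prod_type]
  refine Finset.sum_congr rfl fun i _ => ?_
  rw [Fintype.sum_prod_type]
  refine Finset.sum_congr rfl fun j _ => ?_
  rw [Fin.sum_univ_two]
  simp only [Fin.isValue, ↓reduceIte, one_ne_zero, Real.norm_eq_abs, sq_abs]
  rw [Complex.sq_norm, Complex.normSq_apply]
  ring

/-- Differences of coordinate vectors are coordinate vectors of differences, so
`‖vec A - vec B‖ = ‖A - B‖_F`. [folklore] -/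
theorem norm_vecEuclid_sub (A B : Matrix (Fin N) (Fin N) ℂ) :
    ‖(WithLp.toLp 2 (fun p : Fin N × Fin N × Fin 2 =>
        if p.2.2 = 0 then (A p.1 p.2.1).re else (A p.1 p.2.1).im) :
        EuclideanSpace ℝ (Fin N × Fin N × Fin 2)) -
      WithLp.toLp 2 (fun p : Fin N × Fin N × Fin 2 =>
        if p.2.2 = 0 then (B p.1 p.2.1).re else (B p.1 p.2.1).im)‖ = frobNorm (A - B) := by
  rw [← norm_vecEuclid (A - B), ← WithLp.toLp_sub]
  congr 2
  funext p
  simp only [Pi.sub_apply, Matrix.sub_apply, Complex.sub_re, Complex.sub_im]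
  split_ifs <;> rfl

/-- `A ↦ ‖A‖_F` is continuous. [folklore] -/
theorem continuous_frobNorm' : Continuous fun A : Matrix (Fin N) (Fin N) ℂ => frobNorm A := by
  unfold frobNorm; fun_prop

/-- **Left invariance of Hilbert–Schmidt balls**: for a unitary representation all balls
`{g | ‖ρ g - ρ g₁‖_F ≤ R}` have the same Haar probability. [folklore] -/
theorem haar_frobBall_eq (ρ : G →* Matrix (Fin N) (Fin N) ℂ)
    (hρu : ∀ g, ρ g ∈ Matrix.unitaryGroup (Fin N) ℂ) (g₀ g₁ : G) (R : ℝ) :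
    haarProbability G {g | frobNorm (ρ g - ρ g₁) ≤ R} =
      haarProbability G {g | frobNorm (ρ g - ρ g₀) ≤ R} := by
  have hpre : (fun h => (g₀ * g₁⁻¹) * h) ⁻¹' {g | frobNorm (ρ g - ρ g₀) ≤ R} =
      {g | frobNorm (ρ g - ρ g₁) ≤ R} := by
    ext h
    simp only [mem_preimage, mem_setOf_eq]
    have : ρ (g₀ * g₁⁻¹ * h) - ρ g₀ = ρ (g₀ * g₁⁻¹) * (ρ h - ρ g₁) := by
      rw [mul_sub, ← map_mul, ← map_mul, inv_mul_cancel_right]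
    rw [this, frobNorm_unitary_mul (hρu _)]
  rw [← hpre, measure_preimage_mul]

/-- **Volume doubling of Haar measure for Hilbert–Schmidt balls** on a compact group with a
continuous unitary matrix representation: `σ{‖ρ g - ρ g₀‖_F ≤ 2R} ≤ 5^{2N²} σ{‖ρ g - ρ g₀‖_F ≤ R}`
for all `g₀` and `R ≥ 0` — the Hilbert–Schmidt metric is the restriction of the Euclidean metric of
`ℝ^{2N²}`, which is doubling, and is left invariant. [folklore] -/
theorem haar_frobBall_two_mul_le (ρ : G →* Matrix (Fin N) (Fin N) ℂ) (hρ : Continuous ρ)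
    (hρu : ∀ g, ρ g ∈ Matrix.unitaryGroup (Fin N) ℂ) (g₀ : G) {R : ℝ} (hR : 0 ≤ R) :
    haarProbability G {g | frobNorm (ρ g - ρ g₀) ≤ 2 * R} ≤
      5 ^ (2 * N ^ 2) * haarProbability G {g | frobNorm (ρ g - ρ g₀) ≤ R} := by
  rcases hR.eq_or_lt with rfl | hR'
  · rw [mul_zero]
    refine le_mul_of_one_le_left zero_le ?_
    exact one_le_pow_of_one_le' (by norm_num) _
  set vec : Matrix (Fin N) (Fin N) ℂ → EuclideanSpace ℝ (Fin N × Fin N × Fin 2) := fun A =>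
    WithLp.toLp 2 (fun p : Fin N × Fin N × Fin 2 =>
      if p.2.2 = 0 then (A p.1 p.2.1).re else (A p.1 p.2.1).im) with hvec
  have hsub : ∀ A B, ‖vec A - vec B‖ = frobNorm (A - B) := fun A B => norm_vecEuclid_sub A B
  have hvc : Continuous vec := by
    rw [hvec]
    refine (PiLp.continuous_toLp 2 _).comp ?_
    refine continuous_pi fun p => ?_
    split_ifs
    · exact Complex.continuous_re.comp (continuous_apply_apply _ _)
    · exact Complex.continuous_im.comp (continuous_apply_apply _ _)
  have hf : Measurable (vec ∘ ρ) := (hvc.comp hρ).measurable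
  have hcard : Fintype.card (Fin N × Fin N × Fin 2) = 2 * N ^ 2 := by
    simp [Fintype.card_prod]; ring
  have key := measure_norm_sub_le_two_mul_le (haarProbability G) hf hR' (vec (ρ g₀))
    (V := haarProbability G {g | frobNorm (ρ g - ρ g₀) ≤ R}) (fun g₁ => by
      have : {g | ‖(vec ∘ ρ) g - (vec ∘ ρ) g₁‖ ≤ R} = {g | frobNorm (ρ g - ρ g₁) ≤ R} := by
        ext g; simp only [mem_setOf_eq, Function.comp_apply, hsub]
      rw [this, haar_frobBall_eq ρ hρu g₀ g₁ R])
  have hset : {g | ‖(vec ∘ ρ) g - vec (ρ g₀)‖ ≤ 2 * R} = {g | frobNorm (ρ g - ρ g₀) ≤ 2 * R} := by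
    ext g; simp only [mem_setOf_eq, Function.comp_apply, hsub]
  rwa [hset, hcard] at key

end Group

end Literature.MathematicalPhysics.QuantumFieldTheory

end
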